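import Mathlib
import HarnessLib

/-!
# Burgers-tube heredity: the co-moving-frame chain rule — the columnar flow map's Cartesian
# Jacobian IS the triangular matrix `!![a, 0; b, a]` in the rotated polar frames
# (instab lane, door O-acc = O7, obstruction P3 — `HOME/instab2/HEREDITY-P3.md` (A)(ii), last paper-grade line)

HONEST FRAMING (cell `ns-blowup`, seat `ns-blowup-instab2`; human ruling D-0035): nothing here is a
claim about Navier–Stokes blow-up. WHAT THIS IS NOT: not dynamics of any real flow; it is the
two-variable chain rule that `BurgersColumnarFlowMap.lean` (p404604) named as its one paper-grade
remainder: «the chain-rule line identifying `T = !![a, 0, 0; b, a, 0; 0, 0, c]` with `dF` in the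
co-moving orthonormal frame». There the trajectories, the shear bound `b² ≤ K² a²` and the sandwich for
the abstract triangular `T` are kernel; here we differentiate the ACTUAL planar flow map in Cartesian
coordinates and show that its image energies are those of `T`.

## The planar flow map (written through universally quantified `W`, `G₁`, `G₂` pinned by hypotheses)

At time `t` the transverse part of the columnar swirl's flow map sends the initial point `p = (x, y)`
with `ρ = √(x²+y²)` to `a · R(W(ρ)) p`, where `a = e^{−σt/2}` is the parent's radial contraction and
`W(ρ) = ∫₀ᵗ Ω(ρ e^{−σs/2}) ds` the winding angle (`BurgersColumnarFlowMap.hasDerivAt_angle`), i.e.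
`G₁(x,y) = a (x cos W(ρ) − y sin W(ρ))`, `G₂(x,y) = a (x sin W(ρ) + y cos W(ρ))`.
§1 proves the FOUR PARTIAL DERIVATIVES at an off-axis point `(ρ cos φ, ρ sin φ)`, `ρ > 0`, for ANY
winding profile `W` with `W′(ρ) = D`:
`∂ₓG₁ = a(cos W₀ − ρD cos φ · sin(φ+W₀))`, `∂_yG₁ = a(−sin W₀ − ρD sin φ · sin(φ+W₀))`,
`∂ₓG₂ = a(sin W₀ + ρD cos φ · cos(φ+W₀))`, `∂_yG₂ = a(cos W₀ + ρD sin φ · cos(φ+W₀))`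
(`W₀ = W(ρ)`; `sin/cos(φ+W₀)` written out by the addition formulas). §2 is the CHAIN-RULE LINE: for every
tangent vector `v`, `|J v|² = (a v_r)² + (b v_r + a v_θ)²` with `v_r = cos φ·v₁ + sin φ·v₂`,
`v_θ = −sin φ·v₁ + cos φ·v₂` (components in the polar frame at `p`) and `b = a ρ D` — exactly the
transverse block of `T` — hence, given the shear bound `b² ≤ K²a²`, the two-sided sandwich
`a²|v|²/(2(1+K²)) ≤ |Jv|² ≤ 2(1+K²) a²|v|²`. The instantiation with the swirl's own winding
(`D = ∫₀ᵗ Ω′(ρe^{−σs/2}) e^{−σs/2} ds` by `BurgersColumnarFlowMap.hasDerivAt_angle_radius`, `b² ≤ K²a²`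
with `K = 2ρM/σ` by `BurgersColumnarFlowMap.swirl_shear_sq_le`) is a two-line corollary filed separately
(`BurgersColumnarJacobianSwirl.lean`, which imports that module): EVERY off-axis trajectory of the
columnar swirl has transverse Lyapunov exponents exactly `−σ/2, −σ/2` (the axial one, `σ`, is the
decoupled `z ↦ z e^{σt}`), for every `C¹` swirl profile with bounded `Ω′` — HEREDITY-P3 (A)(iii) with
no paper-grade remainder.

Mathlib only (this file is independent of the swirl: any winding profile `W`). No definitions.
LABEL: MODEL/kinematic bookkeeping.
-/

namespace Summit.NavierStokesRegularity.FluidComputer.BurgersColumnarJacobian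

open Real

section Partials

/-! ## §1 The four partial derivatives of `p ↦ a·R(W(|p|)) p` at `(ρ cos φ, ρ sin φ)`, `ρ > 0` -/

variable {a ρ φ D : ℝ} {W : ℝ → ℝ} {G₁ G₂ : ℝ → ℝ → ℝ}

/-- Off the axis the radius is recovered from the polar parametrisation: `√((ρ cos φ)² + (ρ sin φ)²) = ρ`. -/
theorem sqrt_polar (hρ : 0 ≤ ρ) (φ : ℝ) : Real.sqrt ((ρ * Real.cos φ) ^ 2 + (ρ * Real.sin φ) ^ 2) = ρ := by
  have h : (ρ * Real.cos φ) ^ 2 + (ρ * Real.sin φ) ^ 2 = ρ ^ 2 := by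
    have := Real.cos_sq_add_sin_sq φ
    nlinarith [this]
  rw [h, Real.sqrt_sq hρ]

/-- `∂ρ/∂x = cos φ`: the radius as a function of `x` (at fixed `y = ρ sin φ`). -/
theorem hasDerivAt_radius_dx (hρ : 0 < ρ) (φ : ℝ) :
    HasDerivAt (fun x : ℝ => Real.sqrt (x ^ 2 + (ρ * Real.sin φ) ^ 2)) (Real.cos φ) (ρ * Real.cos φ) := by
  have hin : HasDerivAt (fun x : ℝ => x ^ 2 + (ρ * Real.sin φ) ^ 2) (2 * (ρ * Real.cos φ)) (ρ * Real.cos φ) := by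
    have := (hasDerivAt_pow 2 (ρ * Real.cos φ)).add_const ((ρ * Real.sin φ) ^ 2)
    simpa using this
  have hne : (ρ * Real.cos φ) ^ 2 + (ρ * Real.sin φ) ^ 2 ≠ 0 := by
    have e : (ρ * Real.cos φ) ^ 2 + (ρ * Real.sin φ) ^ 2 = ρ ^ 2 := by nlinarith [Real.cos_sq_add_sin_sq φ]
    rw [e]; positivity
  have h := hin.sqrt hne
  refine h.congr_deriv ?_
  rw [sqrt_polar hρ.le]
  field_simp

/-- `∂ρ/∂y = sin φ`. -/
theorem hasDerivAt_radius_dy (hρ : 0 < ρ) (φ : ℝ) :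
    HasDerivAt (fun y : ℝ => Real.sqrt ((ρ * Real.cos φ) ^ 2 + y ^ 2)) (Real.sin φ) (ρ * Real.sin φ) := by
  have hin : HasDerivAt (fun y : ℝ => (ρ * Real.cos φ) ^ 2 + y ^ 2) (2 * (ρ * Real.sin φ)) (ρ * Real.sin φ) := by
    have := (hasDerivAt_pow 2 (ρ * Real.sin φ)).const_add ((ρ * Real.cos φ) ^ 2)
    simpa using this
  have hne : (ρ * Real.cos φ) ^ 2 + (ρ * Real.sin φ) ^ 2 ≠ 0 := by
    have e : (ρ * Real.cos φ) ^ 2 + (ρ * Real.sin φ) ^ 2 = ρ ^ 2 := by nlinarith [Real.cos_sq_add_sin_sq φ]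
    rw [e]; positivity
  have h := hin.sqrt hne
  refine h.congr_deriv ?_
  rw [sqrt_polar hρ.le]
  field_simp

/-- `∂ₓ G₁ = a (cos W₀ − ρ D cos φ (cos φ sin W₀ + sin φ cos W₀))` at `(ρ cos φ, ρ sin φ)`, for any
winding profile with `W′(ρ) = D` (`W₀ = W(ρ)`). -/
theorem hasDerivAt_G1_dx (hρ : 0 < ρ) (hW : HasDerivAt W D ρ)
    (hG₁ : ∀ x y, G₁ x y = a * (x * Real.cos (W (Real.sqrt (x ^ 2 + y ^ 2))) - y * Real.sin (W (Real.sqrt (x ^ 2 + y ^ 2))))) :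
    HasDerivAt (fun x => G₁ x (ρ * Real.sin φ))
      (a * (Real.cos (W ρ) - ρ * D * Real.cos φ * (Real.cos φ * Real.sin (W ρ) + Real.sin φ * Real.cos (W ρ)))) (ρ * Real.cos φ) := by
  have hfun : (fun x => G₁ x (ρ * Real.sin φ)) = fun x => a * (x * Real.cos (W (Real.sqrt (x ^ 2 + (ρ * Real.sin φ) ^ 2)))
      - (ρ * Real.sin φ) * Real.sin (W (Real.sqrt (x ^ 2 + (ρ * Real.sin φ) ^ 2)))) := by
    funext x; rw [hG₁]
  rw [hfun]
  have hW' : HasDerivAt W D (Real.sqrt ((ρ * Real.cos φ) ^ 2 + (ρ * Real.sin φ) ^ 2)) := by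
    rw [sqrt_polar hρ.le]; exact hW
  have hWr := HasDerivAt.comp (h₂ := W) (h := fun x : ℝ => Real.sqrt (x ^ 2 + (ρ * Real.sin φ) ^ 2)) (ρ * Real.cos φ) hW' (hasDerivAt_radius_dx hρ φ)
  have hc := hWr.cos
  have hs := hWr.sin
  have h := (((hasDerivAt_id' (ρ * Real.cos φ)).mul hc).sub (hs.const_mul (ρ * Real.sin φ))).const_mul a
  refine h.congr_deriv ?_
  simp only [Function.comp, sqrt_polar hρ.le]
  ring

/-- `∂_y G₁ = a (−sin W₀ − ρ D sin φ (cos φ sin W₀ + sin φ cos W₀))`. -/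
theorem hasDerivAt_G1_dy (hρ : 0 < ρ) (hW : HasDerivAt W D ρ)
    (hG₁ : ∀ x y, G₁ x y = a * (x * Real.cos (W (Real.sqrt (x ^ 2 + y ^ 2))) - y * Real.sin (W (Real.sqrt (x ^ 2 + y ^ 2))))) :
    HasDerivAt (fun y => G₁ (ρ * Real.cos φ) y)
      (a * (-Real.sin (W ρ) - ρ * D * Real.sin φ * (Real.cos φ * Real.sin (W ρ) + Real.sin φ * Real.cos (W ρ)))) (ρ * Real.sin φ) := by
  have hfun : (fun y => G₁ (ρ * Real.cos φ) y) = fun y => a * ((ρ * Real.cos φ) * Real.cos (W (Real.sqrt ((ρ * Real.cos φ) ^ 2 + y ^ 2)))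
      - y * Real.sin (W (Real.sqrt ((ρ * Real.cos φ) ^ 2 + y ^ 2)))) := by
    funext y; rw [hG₁]
  rw [hfun]
  have hW' : HasDerivAt W D (Real.sqrt ((ρ * Real.cos φ) ^ 2 + (ρ * Real.sin φ) ^ 2)) := by
    rw [sqrt_polar hρ.le]; exact hW
  have hWr := HasDerivAt.comp (h₂ := W) (h := fun y : ℝ => Real.sqrt ((ρ * Real.cos φ) ^ 2 + y ^ 2)) (ρ * Real.sin φ) hW' (hasDerivAt_radius_dy hρ φ)
  have hc := hWr.cos
  have hs := hWr.sin
  have h := ((hc.const_mul (ρ * Real.cos φ)).sub ((hasDerivAt_id' (ρ * Real.sin φ)).mul hs)).const_mul a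
  refine h.congr_deriv ?_
  simp only [Function.comp, sqrt_polar hρ.le]
  ring

/-- `∂ₓ G₂ = a (sin W₀ + ρ D cos φ (cos φ cos W₀ − sin φ sin W₀))`. -/
theorem hasDerivAt_G2_dx (hρ : 0 < ρ) (hW : HasDerivAt W D ρ)
    (hG₂ : ∀ x y, G₂ x y = a * (x * Real.sin (W (Real.sqrt (x ^ 2 + y ^ 2))) + y * Real.cos (W (Real.sqrt (x ^ 2 + y ^ 2))))) :
    HasDerivAt (fun x => G₂ x (ρ * Real.sin φ))
      (a * (Real.sin (W ρ) + ρ * D * Real.cos φ * (Real.cos φ * Real.cos (W ρ) - Real.sin φ * Real.sin (W ρ)))) (ρ * Real.cos φ) := by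
  have hfun : (fun x => G₂ x (ρ * Real.sin φ)) = fun x => a * (x * Real.sin (W (Real.sqrt (x ^ 2 + (ρ * Real.sin φ) ^ 2)))
      + (ρ * Real.sin φ) * Real.cos (W (Real.sqrt (x ^ 2 + (ρ * Real.sin φ) ^ 2)))) := by
    funext x; rw [hG₂]
  rw [hfun]
  have hW' : HasDerivAt W D (Real.sqrt ((ρ * Real.cos φ) ^ 2 + (ρ * Real.sin φ) ^ 2)) := by
    rw [sqrt_polar hρ.le]; exact hW
  have hWr := HasDerivAt.comp (h₂ := W) (h := fun x : ℝ => Real.sqrt (x ^ 2 + (ρ * Real.sin φ) ^ 2)) (ρ * Real.cos φ) hW' (hasDerivAt_radius_dx hρ φ)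
  have hc := hWr.cos
  have hs := hWr.sin
  have h := (((hasDerivAt_id' (ρ * Real.cos φ)).mul hs).add (hc.const_mul (ρ * Real.sin φ))).const_mul a
  refine h.congr_deriv ?_
  simp only [Function.comp, sqrt_polar hρ.le]
  ring

/-- `∂_y G₂ = a (cos W₀ + ρ D sin φ (cos φ cos W₀ − sin φ sin W₀))`. -/
theorem hasDerivAt_G2_dy (hρ : 0 < ρ) (hW : HasDerivAt W D ρ)
    (hG₂ : ∀ x y, G₂ x y = a * (x * Real.sin (W (Real.sqrt (x ^ 2 + y ^ 2))) + y * Real.cos (W (Real.sqrt (x ^ 2 + y ^ 2))))) :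
    HasDerivAt (fun y => G₂ (ρ * Real.cos φ) y)
      (a * (Real.cos (W ρ) + ρ * D * Real.sin φ * (Real.cos φ * Real.cos (W ρ) - Real.sin φ * Real.sin (W ρ)))) (ρ * Real.sin φ) := by
  have hfun : (fun y => G₂ (ρ * Real.cos φ) y) = fun y => a * ((ρ * Real.cos φ) * Real.sin (W (Real.sqrt ((ρ * Real.cos φ) ^ 2 + y ^ 2)))
      + y * Real.cos (W (Real.sqrt ((ρ * Real.cos φ) ^ 2 + y ^ 2)))) := by
    funext y; rw [hG₂]
  rw [hfun]
  have hW' : HasDerivAt W D (Real.sqrt ((ρ * Real.cos φ) ^ 2 + (ρ * Real.sin φ) ^ 2)) := by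
    rw [sqrt_polar hρ.le]; exact hW
  have hWr := HasDerivAt.comp (h₂ := W) (h := fun y : ℝ => Real.sqrt ((ρ * Real.cos φ) ^ 2 + y ^ 2)) (ρ * Real.sin φ) hW' (hasDerivAt_radius_dy hρ φ)
  have hc := hWr.cos
  have hs := hWr.sin
  have h := ((hs.const_mul (ρ * Real.cos φ)).add ((hasDerivAt_id' (ρ * Real.sin φ)).mul hc)).const_mul a
  refine h.congr_deriv ?_
  simp only [Function.comp, sqrt_polar hρ.le]
  ring

end Partials

section ChainRule

/-! ## §2 THE CHAIN-RULE LINE: `|J v|² = (a v_r)² + (b v_r + a v_θ)²` with `b = a ρ D`, and the sandwich -/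

/-- **Co-moving-frame identity.** With the four partials of §1 as the Jacobian `J` (symbols `cW = cos W₀`,
`sW = sin W₀`, `cφ = cos φ`, `sφ = sin φ`, only `cW² + sW² = 1 = cφ² + sφ²` used), for every tangent vector
`(v₁, v₂)`: `|Jv|² = (a v_r)² + (aρD · v_r + a v_θ)²`, `v_r = cφ v₁ + sφ v₂`, `v_θ = −sφ v₁ + cφ v₂` — the
transverse block `!![a, 0; b, a]`, `b = aρD`, of `BurgersColumnarFlowMap`'s `T`, acting between the polar
frame at `p` and the rotated polar frame at the image. -/
theorem jacobian_frame_identity (a ρ D v₁ v₂ : ℝ) {cW sW cφ sφ : ℝ} (hW : cW ^ 2 + sW ^ 2 = 1) (hφ : cφ ^ 2 + sφ ^ 2 = 1) :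
    (a * (cW - ρ * D * cφ * (cφ * sW + sφ * cW)) * v₁ + a * (-sW - ρ * D * sφ * (cφ * sW + sφ * cW)) * v₂) ^ 2
      + (a * (sW + ρ * D * cφ * (cφ * cW - sφ * sW)) * v₁ + a * (cW + ρ * D * sφ * (cφ * cW - sφ * sW)) * v₂) ^ 2
      = (a * (cφ * v₁ + sφ * v₂)) ^ 2 + (a * ρ * D * (cφ * v₁ + sφ * v₂) + a * (-sφ * v₁ + cφ * v₂)) ^ 2 := by
  linear_combination (a ^ 2 * ((v₁ ^ 2 + v₂ ^ 2) + 2 * D * ρ * (cφ * v₁ + sφ * v₂) * (-sφ * v₁ + cφ * v₂)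
      + D ^ 2 * (cφ * v₁ + sφ * v₂) ^ 2 * ρ ^ 2 * (cφ ^ 2 + sφ ^ 2))) * hW
    + (a ^ 2 * (D ^ 2 * (cφ * v₁ + sφ * v₂) ^ 2 * ρ ^ 2 - (v₁ ^ 2 + v₂ ^ 2))) * hφ

/-- The polar frame is orthonormal: `v_r² + v_θ² = v₁² + v₂²`. -/
theorem polar_components_sq (v₁ v₂ : ℝ) {cφ sφ : ℝ} (hφ : cφ ^ 2 + sφ ^ 2 = 1) :
    (cφ * v₁ + sφ * v₂) ^ 2 + (-sφ * v₁ + cφ * v₂) ^ 2 = v₁ ^ 2 + v₂ ^ 2 := by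
  linear_combination (v₁ ^ 2 + v₂ ^ 2) * hφ

/-- The `2 × 2` triangular sandwich (cf. `BurgersColumnarFlowMap.transverse_energy_le/_ge`): if
`b² ≤ K² a²` then `a²(v_r² + v_θ²) ≤ 2(1+K²)((a v_r)² + (b v_r + a v_θ)²)` and
`(a v_r)² + (b v_r + a v_θ)² ≤ 2(1+K²) a²(v_r² + v_θ²)`. -/
theorem triangular_sandwich_2d {a b K : ℝ} (hb : b ^ 2 ≤ K ^ 2 * a ^ 2) (vr vθ : ℝ) :
    a ^ 2 * (vr ^ 2 + vθ ^ 2) ≤ 2 * (1 + K ^ 2) * ((a * vr) ^ 2 + (b * vr + a * vθ) ^ 2) ∧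
      (a * vr) ^ 2 + (b * vr + a * vθ) ^ 2 ≤ 2 * (1 + K ^ 2) * (a ^ 2 * (vr ^ 2 + vθ ^ 2)) := by
  have h1 : (b * vr) ^ 2 ≤ K ^ 2 * (a * vr) ^ 2 := by nlinarith [sq_nonneg vr]
  constructor
  · nlinarith [sq_nonneg (b * vr + a * vθ + b * vr), sq_nonneg (b * vr - a * vθ), sq_nonneg (a * vθ + 2 * b * vr), sq_nonneg K, sq_nonneg (K * (a * vr)), sq_nonneg (a*vr), sq_nonneg (b * vr + a * vθ)]
  · nlinarith [sq_nonneg (b * vr - a * vθ), sq_nonneg K, sq_nonneg (a * vr), sq_nonneg (a * vθ), sq_nonneg (K * a * vr)]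

/-- **HEREDITY-P3 (A)(iii) for the ACTUAL flow map, transverse part.** For any winding profile with
`W′(ρ) = D` at the off-axis point `(ρ cos φ, ρ sin φ)` and any shear constant `K` with `(aρD)² ≤ K²a²`,
the Cartesian Jacobian `J` of `p ↦ a R(W(|p|)) p` (entries = the four partials of §1) satisfies
`a²|v|²/(2(1+K²)) ≤ |Jv|² ≤ 2(1+K²) a²|v|²` for every `v` — growth rate exactly that of `a`, the
winding entering only through the bounded distortion `2(1+K²)`. -/
theorem planar_jacobian_sandwich (a ρ D φ W₀ v₁ v₂ : ℝ) {K : ℝ} (hb : (a * ρ * D) ^ 2 ≤ K ^ 2 * a ^ 2) :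
    let J₁₁ := a * (Real.cos W₀ - ρ * D * Real.cos φ * (Real.cos φ * Real.sin W₀ + Real.sin φ * Real.cos W₀))
    let J₁₂ := a * (-Real.sin W₀ - ρ * D * Real.sin φ * (Real.cos φ * Real.sin W₀ + Real.sin φ * Real.cos W₀))
    let J₂₁ := a * (Real.sin W₀ + ρ * D * Real.cos φ * (Real.cos φ * Real.cos W₀ - Real.sin φ * Real.sin W₀))
    let J₂₂ := a * (Real.cos W₀ + ρ * D * Real.sin φ * (Real.cos φ * Real.cos W₀ - Real.sin φ * Real.sin W₀))
    a ^ 2 * (v₁ ^ 2 + v₂ ^ 2) ≤ 2 * (1 + K ^ 2) * ((J₁₁ * v₁ + J₁₂ * v₂) ^ 2 + (J₂₁ * v₁ + J₂₂ * v₂) ^ 2) ∧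
      (J₁₁ * v₁ + J₁₂ * v₂) ^ 2 + (J₂₁ * v₁ + J₂₂ * v₂) ^ 2 ≤ 2 * (1 + K ^ 2) * (a ^ 2 * (v₁ ^ 2 + v₂ ^ 2)) := by
  intro J₁₁ J₁₂ J₂₁ J₂₂
  have hW := Real.cos_sq_add_sin_sq W₀
  have hφ := Real.cos_sq_add_sin_sq φ
  have hid := jacobian_frame_identity a ρ D v₁ v₂ hW hφ
  have hpol := polar_components_sq v₁ v₂ hφ
  have hsand := triangular_sandwich_2d hb (Real.cos φ * v₁ + Real.sin φ * v₂) (-Real.sin φ * v₁ + Real.cos φ * v₂)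
  show a ^ 2 * (v₁ ^ 2 + v₂ ^ 2) ≤ 2 * (1 + K ^ 2) * ((a * (Real.cos W₀ - ρ * D * Real.cos φ * (Real.cos φ * Real.sin W₀ + Real.sin φ * Real.cos W₀)) * v₁
      + a * (-Real.sin W₀ - ρ * D * Real.sin φ * (Real.cos φ * Real.sin W₀ + Real.sin φ * Real.cos W₀)) * v₂) ^ 2
      + (a * (Real.sin W₀ + ρ * D * Real.cos φ * (Real.cos φ * Real.cos W₀ - Real.sin φ * Real.sin W₀)) * v₁
      + a * (Real.cos W₀ + ρ * D * Real.sin φ * (Real.cos φ * Real.cos W₀ - Real.sin φ * Real.sin W₀)) * v₂) ^ 2) ∧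
    (a * (Real.cos W₀ - ρ * D * Real.cos φ * (Real.cos φ * Real.sin W₀ + Real.sin φ * Real.cos W₀)) * v₁
      + a * (-Real.sin W₀ - ρ * D * Real.sin φ * (Real.cos φ * Real.sin W₀ + Real.sin φ * Real.cos W₀)) * v₂) ^ 2
      + (a * (Real.sin W₀ + ρ * D * Real.cos φ * (Real.cos φ * Real.cos W₀ - Real.sin φ * Real.sin W₀)) * v₁
      + a * (Real.cos W₀ + ρ * D * Real.sin φ * (Real.cos φ * Real.cos W₀ - Real.sin φ * Real.sin W₀)) * v₂) ^ 2
      ≤ 2 * (1 + K ^ 2) * (a ^ 2 * (v₁ ^ 2 + v₂ ^ 2))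
  rw [hid, ← hpol]
  exact hsand

end ChainRule


end Summit.NavierStokesRegularity.FluidComputer.BurgersColumnarJacobian
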